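import Summits.QuantumFields.YangMills.Theorems.UnitScaleTiltProp7PinnedKernelL1OfRows
import Summits.QuantumFields.YangMills.Theorems.UnitScaleTiltProp7PinnedGreenSymmetry
import Summits.QuantumFields.YangMills.Theorems.UnitScaleTiltProp7PinnedKernelBumps
import Summits.QuantumFields.YangMills.Theorems.UnitScaleTiltProp7PinnedKernelNearField
import Summits.QuantumFields.YangMills.Theorems.UnitScaleTiltProp7GreenKernelSiteFree
import Summits.QuantumFields.YangMills.Theorems.UnitScaleTiltProp7CentrePinnedHessianPoincare
import Summits.QuantumFields.YangMills.Theorems.UnitScaleTiltProp7TorusAgmonWeight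
import HarnessLib

/-!
# Route `UnitScaleTilt`, crux K1 «MinimiserStabilityRegPr» (stmt-QuantumFields-19200), route-R E′ path (α′), residue (hK), assembly (A), file (F-a, part 1 of 2):
# THE INSTANTIATION'S LETTERS — both branches of the bump family in one package, the `Σω⁻²` count for the (W1) weight, the pointwise rows of `V = Gf b₊ − Gf b₋` and
# `g = ΔV` ON THE ANNULUS read from the (R5c)∕(N)∕(Hess3) rows, and the no-wrap inequality for the near-field radius

Cell `ym3-torus`, width seat `ym3-torus-px22` (gen 2) = the (A)-instantiation seat (★routeR-w3 g5 19:59:56Z); LOCATE 19200 evidence `LOCATE-A3-FARFIELD-px22g2.md` v1.2.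
`--supports stmt-QuantumFields-19200`, count-neutral.  THEOREMS ONLY (0 `def`, 0 `sorry`).  YM₃ on T³ is a ladder rung (R3), not the Clay problem; nothing here claims the stub, the crux,
d = 4 or the gap.

WHAT IS PROVED (ns `…Theorems.Prop7PinnedKernelL1Rows`).
* §1 `exists_bump_package` (✓ `exists_bump_family` for `10√d+4 ≤ ℓ`, ✓ `exists_delta_family` otherwise; uniform `B_β ≤ 13dc²(10√d+4)²∕ℓ²`, `0 ≤ r_S ≤ ℓ`), `sqrt_sum_inv_sq_le`
  (`√Σω⁻² ≤ √((2(1+(4κ∕(π√dℓ))⁻¹))^d)`).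
* §1b `abs_symmDiff_le_of_grad_row` (`|V(z+μ) − V(z−μ)| ≤ 2D√d∕(ℓ₀−2)` on `{tdist(·,b₋) > ℓ₀−1}` from the (R5c) gradient row), `abs_g_le_of_row` (`|g| ≤ D∕(ℓ₀−2)²`),
  `abs_g_diff_le_of_row` (`|g(z+μ) − g z| ≤ D∕(ℓ₀−3)³`), `near_radius_lt` (`2⌈5√d·2ℓ⌉₊ < L^k·sitesPerDir k` for `d = 3`, `sitesPerDir k ≥ 40`).
HONEST SCOPE.  Letters for part 2 (`…PinnedKernelL1Explicit`).

References: T. Bałaban, CMP 96 (1984) 223–250 [Balaban1984PropagatorsII] ((1.9) p.226, (2.61) p.234); CMP 99 (1985) 75–102 [Balaban1985RegularSpaces] ((1.14) p.78, (1.36) p.82).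
-/

set_option autoImplicit false

noncomputable section

open scoped BigOperators

namespace Summit.QuantumFields.YangMills.Theorems.Prop7PinnedKernelL1Rows

open Literature.MathematicalPhysics.QuantumFieldTheory.Balaban1983to89
open Finset LatticeFieldCalculus
open B15DeterminingSets (embIter)
open B5Eq117TorusCarriers (EK)
open Literature.Probability.LatticeModels (torusGreen TorusSite latticeMomentum dispersion)
open B3Taylor310LocalRemainder (tdist_comm tdist_self tdist_triangle)
open Summit.QuantumFields.YangMills.Theorems.Prop7CentreHarmonicInterpKernel (laplace_sub')
open Summit.QuantumFields.YangMills.Theorems.Prop7PinnedBiharmonicAgmonDecay (poincare_root_of_sq)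
open Summit.QuantumFields.YangMills.Theorems.Prop7TorusAgmonWeight (exists_admissible_weight exists_scale_cutoff)
open Summit.QuantumFields.YangMills.Theorems.Prop7TorusExpWeightSum (sum_exp_neg_mul_tdist_le)
open Summit.QuantumFields.YangMills.Theorems.Prop7PinnedKernelL1OfRows (sum_abs_laplace_sub_interp_le_of_rows)
open Summit.QuantumFields.YangMills.Theorems.Prop7PinnedGreenSymmetry (exists_pinned_interp_of_green)
open Summit.QuantumFields.YangMills.Theorems.Prop7PinnedKernelSources (sqrt_sum_sq_weighted_h_le sqrt_sum_sq_weighted_ht_le sqrt_sum_sq_weighted_s_le sum_abs_laplace_mul_le)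
open Summit.QuantumFields.YangMills.Theorems.Prop7PinnedKernelBumps (bump_ext_apply_centre sum_abs_laplace_bump_ext_le sqrt_sum_sq_weighted_laplace_bump_ext_le)
open Summit.QuantumFields.YangMills.Theorems.Prop7PinnedKernelGeometry (locally_const_off_annulus card_annulus_le card_filter_tdist_lt_le pow_le_tdist_embIter_of_ne
  exists_bump_family exists_delta_family tdist_shift_le_add_one tdist_le_tdist_shift_add_one tdist_unshift_le_add_one tdist_le_tdist_unshift_add_one)
open Summit.QuantumFields.YangMills.Theorems.Prop7PinnedKernelNearField (sum_abs_mul_near_le abs_g_mul_tdist_sq_le abs_g_shift_sub_g_mul_tdist_cube_le)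
open Summit.QuantumFields.YangMills.Theorems.Prop7GreenKernelSiteRows (abs_free_sub_free_le_of_grad_bound exists_grad_free_sub_free_const tdist_sq_le_card_mul_sum_sq)
open Summit.QuantumFields.YangMills.Theorems.Prop7CentrePinnedHessianPoincare (sum_sq_le_laplace_sq_of_vanish_on_range)

variable {P : Params}

/-! ## §1 The bump family in one package (both branches), and the `Σω⁻²` count -/

/-- **BOTH BRANCHES OF THE BUMP FAMILY IN ONE PACKAGE**: for `3 ≤ L^k` there are bumps `β_y` at the centres with a uniform Laplacian bound `B_β ≤ 13·d·c²·(10√d+4)²∕ℓ²` (`ℓ = L^k`),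
supports `S_y = {tdist(·,e_y) < r_S + 1}` with `0 ≤ r_S ≤ ℓ`, pairwise disjoint (✓ `exists_bump_family` when `10√d + 4 ≤ ℓ`, ✓ `exists_delta_family` otherwise). [cite: Balaban1985RegularSpaces, (1.14) p.78] -/
theorem exists_bump_package [DecidableEq (Site P 0)] {k : ℕ} (hk : k ≤ P.m + P.K) (h3 : 3 ≤ P.L ^ k) (c : ℝ) :
    ∃ (β : Site P k → SiteField P 0 ℝ) (Bβ rS : ℝ),
      0 ≤ Bβ ∧ Bβ ≤ 13 * P.d * c ^ 2 * (10 * Real.sqrt P.d + 4) ^ 2 / ((P.L : ℝ) ^ k) ^ 2 ∧ 0 ≤ rS ∧ rS ≤ (P.L : ℝ) ^ k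
      ∧ (∀ y, β y (embIter k y) = 1)
      ∧ (∀ y y', y ≠ y' → β y (embIter k y') = 0)
      ∧ (∀ y z, |laplace c (β y) z| ≤ Bβ)
      ∧ (∀ y z, z ∉ (Finset.univ.filter fun z : Site P 0 => (Site.tdist z (embIter k y) : ℝ) < rS + 1) → laplace c (β y) z = 0)
      ∧ ∀ y y', y ≠ y' → Disjoint
          (Finset.univ.filter fun z : Site P 0 => (Site.tdist z (embIter k y) : ℝ) < rS + 1)
          (Finset.univ.filter fun z : Site P 0 => (Site.tdist z (embIter k y') : ℝ) < rS + 1) := by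
  have hsd : 0 ≤ Real.sqrt P.d := Real.sqrt_nonneg _
  have hd0 : (0 : ℝ) ≤ P.d := Nat.cast_nonneg _
  set ℓ : ℝ := (P.L : ℝ) ^ k with hℓ
  have hℓ3 : (3 : ℝ) ≤ ℓ := by rw [hℓ]; exact_mod_cast h3
  have hℓ0 : 0 < ℓ := by linarith
  by_cases hbig : 10 * Real.sqrt P.d + 4 ≤ ℓ
  · -- smooth branch
    set ℓβ : ℝ := ℓ / (10 * Real.sqrt P.d + 4) with hℓβ
    have hden : 0 < 10 * Real.sqrt P.d + 4 := by positivity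
    have hℓβ1 : 1 ≤ ℓβ := by rw [hℓβ, le_div_iff₀ hden]; linarith
    have hℓβ0 : 0 < ℓβ := by linarith
    have hsep : 2 * (5 * Real.sqrt P.d * ℓβ + 1) ≤ (P.L : ℝ) ^ k := by
      rw [← hℓ]
      have e : 5 * Real.sqrt P.d * ℓβ = ℓ * (5 * Real.sqrt P.d) / (10 * Real.sqrt P.d + 4) := by rw [hℓβ]; ring
      rw [e]
      rw [show 2 * (ℓ * (5 * Real.sqrt P.d) / (10 * Real.sqrt P.d + 4) + 1) = (ℓ * (10 * Real.sqrt P.d) + 2 * (10 * Real.sqrt P.d + 4)) / (10 * Real.sqrt P.d + 4) by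
        field_simp; ring]
      rw [div_le_iff₀ hden]
      nlinarith
    obtain ⟨β, h1, h0, hB, hS, hdisj⟩ := exists_bump_family (P := P) hk hℓβ1 hsep
    refine ⟨β, 9 * P.d * c ^ 2 / ℓβ ^ 2, 5 * Real.sqrt P.d * ℓβ, by positivity, ?_, by positivity, ?_, h1, h0, fun y z => hB c y z, fun y z hz => hS c y z hz, hdisj⟩
    · -- `9dc²/ℓ_β² = 9dc²(10√d+4)²/ℓ² ≤ 13dc²(10√d+4)²/ℓ²`
      have e : 9 * P.d * c ^ 2 / ℓβ ^ 2 = 9 * P.d * c ^ 2 * (10 * Real.sqrt P.d + 4) ^ 2 / ℓ ^ 2 := by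
        rw [hℓβ]; field_simp
      rw [e]
      apply div_le_div_of_nonneg_right _ (by positivity)
      nlinarith [sq_nonneg c, sq_nonneg (10 * Real.sqrt P.d + 4), mul_nonneg hd0 (sq_nonneg c)]
    · -- `5√d·ℓ_β ≤ ℓ`
      rw [hℓβ]
      rw [show 5 * Real.sqrt P.d * (ℓ / (10 * Real.sqrt P.d + 4)) = ℓ * (5 * Real.sqrt P.d) / (10 * Real.sqrt P.d + 4) by ring, div_le_iff₀ hden]
      nlinarith
  · -- delta branch
    push Not at hbig
    obtain ⟨β, h1, h0, hB, hS, hdisj⟩ := exists_delta_family (P := P) hk h3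
    refine ⟨β, 4 * P.d * c ^ 2, 1, by positivity, ?_, zero_le_one, by linarith, h1, h0, fun y z => hB c y z, fun y z hz => hS c y z hz, hdisj⟩
    -- `4dc² ≤ 13dc²(10√d+4)²/ℓ²` since `ℓ < 10√d + 4`
    rw [le_div_iff₀ (by positivity)]
    have h1' : ℓ ^ 2 ≤ (10 * Real.sqrt P.d + 4) ^ 2 := pow_le_pow_left₀ hℓ0.le hbig.le 2
    have hdc : 0 ≤ (P.d : ℝ) * c ^ 2 := mul_nonneg hd0 (sq_nonneg c)
    calc 4 * (P.d : ℝ) * c ^ 2 * ℓ ^ 2 = 4 * ((P.d : ℝ) * c ^ 2) * ℓ ^ 2 := by ring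
      _ ≤ 4 * ((P.d : ℝ) * c ^ 2) * (10 * Real.sqrt P.d + 4) ^ 2 := mul_le_mul_of_nonneg_left h1' (by positivity)
      _ ≤ 13 * ((P.d : ℝ) * c ^ 2) * (10 * Real.sqrt P.d + 4) ^ 2 := by nlinarith [sq_nonneg (10 * Real.sqrt P.d + 4)]
      _ = 13 * P.d * c ^ 2 * (10 * Real.sqrt P.d + 4) ^ 2 := by ring

/-- **THE `Σω⁻²` COUNT** for the (W1) weight at base `y`, rate `κ > 0`, scale `ℓ ≥ 1`: `√Σ_z (ω z)⁻² ≤ √((2(1 + (4κ∕(π√d·ℓ))⁻¹))^d)` (✓ `sum_exp_neg_mul_tdist_le`). [cite: Balaban1984PropagatorsII, (2.61) p.234] -/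
theorem sqrt_sum_inv_sq_le {j : ℕ} (y : Site P j) (ω : SiteField P j ℝ) {κ ℓ : ℝ} (hκ0 : 0 < κ) (hℓ0 : 0 < ℓ)
    (hlo : ∀ x, Real.exp (2 * κ / (Real.pi * Real.sqrt P.d * ℓ) * (Site.tdist x y : ℝ)) ≤ ω x) :
    Real.sqrt (∑ z, (ω z)⁻¹ ^ 2) ≤ Real.sqrt ((2 * (1 + 1 / (4 * κ / (Real.pi * Real.sqrt P.d * ℓ)))) ^ P.d) := by
  have hπ := Real.pi_pos
  have hd0 : 0 < (P.d : ℝ) := by exact_mod_cast Nat.lt_of_lt_of_le Nat.zero_lt_one P.hd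
  have hsd : 0 < Real.sqrt P.d := Real.sqrt_pos.mpr hd0
  set a' : ℝ := 4 * κ / (Real.pi * Real.sqrt P.d * ℓ) with ha'
  have ha'0 : 0 < a' := by rw [ha']; positivity
  refine Real.sqrt_le_sqrt (le_trans (Finset.sum_le_sum fun z _ => ?_) (sum_exp_neg_mul_tdist_le y ha'0))
  have hz := hlo z
  have e1 : Real.exp (-(a' * (Site.tdist z y : ℝ))) = (Real.exp (2 * κ / (Real.pi * Real.sqrt P.d * ℓ) * (Site.tdist z y : ℝ)) ^ 2)⁻¹ := by
    rw [← Real.exp_nat_mul, ← Real.exp_neg, ha']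
    congr 1
    push_cast
    ring
  rw [e1, inv_pow]
  exact inv_anti₀ (by positivity) (pow_le_pow_left₀ (Real.exp_pos _).le hz 2)

/-! ## §1b The pointwise rows on the annulus, as separate letters (keeps the assembly under the heartbeat budget) -/

/-- **(R5c) GRADIENT ROW ⇒ SYMMETRIC-DIFFERENCE ROW ON THE ANNULUS**: if `|V(z+e_ν) − V(z)|·√(Σ((EK z − EK b₋)ν′)̃²) ≤ D` for `z ≠ b₋` (`D ≥ 0`), then for
`tdist(z,b₋) > ℓ₀ − 1` (`ℓ₀ ≥ 3`): `|V(z+e_μ) − V(z−e_μ)| ≤ 2D√d∕(ℓ₀ − 2)`. [cite: Balaban1985RegularSpaces, (1.36) p.82] -/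
theorem abs_symmDiff_le_of_grad_row {k : ℕ} (hk : k ≤ P.m + P.K) (b : PBond P 0) (V : SiteField P 0 ℝ) {D ℓ₀ : ℝ} (hD : 0 ≤ D) (hℓ₀ : 3 ≤ ℓ₀)
    (hV1 : ∀ z (ν : Fin P.d), z ≠ b.src → |V (z.shift ν) - V z| * Real.sqrt (∑ q, ((((EK hk z - EK hk b.src) q).valMinAbs : ℤ) : ℝ) ^ 2) ≤ D)
    (z : Site P 0) (hz : ℓ₀ - 1 < (Site.tdist z b.src : ℝ)) (μ : Fin P.d) :
    |V (z.shift μ) - V (z.unshift μ)| ≤ 2 * (D * Real.sqrt P.d) / (ℓ₀ - 2) := by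
  have hsd : 0 ≤ Real.sqrt P.d := Real.sqrt_nonneg _
  have hd0 : (0 : ℝ) ≤ P.d := Nat.cast_nonneg _
  have hℓ2 : 0 < ℓ₀ - 2 := by linarith
  -- one forward step from any `w` with `tdist(w,b₋) > ℓ₀ − 2`
  have hstep : ∀ w (ν : Fin P.d), ℓ₀ - 2 < (Site.tdist w b.src : ℝ) → |V (w.shift ν) - V w| ≤ D * Real.sqrt P.d / (ℓ₀ - 2) := by
    intro w ν hw
    have hwne : w ≠ b.src := by
      intro h; rw [h, B3Taylor310LocalRemainder.tdist_self] at hw; push_cast at hw; linarith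
    set S := Real.sqrt (∑ q, ((((EK hk w - EK hk b.src) q).valMinAbs : ℤ) : ℝ) ^ 2) with hS
    have hdl : (Site.tdist w b.src : ℝ) ≤ Real.sqrt P.d * S := by
      have h := tdist_sq_le_card_mul_sum_sq hk w b.src
      have ht0 : (0 : ℝ) ≤ (Site.tdist w b.src : ℝ) := Nat.cast_nonneg _
      rw [hS, ← Real.sqrt_mul hd0, ← Real.sqrt_sq ht0]
      exact Real.sqrt_le_sqrt h
    have hS1 : ℓ₀ - 2 < Real.sqrt P.d * S := lt_of_lt_of_le hw hdl
    have hS0 : 0 < S := by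
      by_contra h0; push Not at h0
      have : Real.sqrt P.d * S ≤ 0 := mul_nonpos_iff.mpr (Or.inl ⟨hsd, h0⟩)
      linarith
    have h := hV1 w ν hwne
    have h1 : |V (w.shift ν) - V w| ≤ D / S := by rw [le_div_iff₀ hS0]; exact h
    have h2 : 1 / S ≤ Real.sqrt P.d / (ℓ₀ - 2) := by
      rw [div_le_div_iff₀ hS0 hℓ2]; linarith [hS1]
    calc |V (w.shift ν) - V w| ≤ D / S := h1
      _ = D * (1 / S) := by ring
      _ ≤ D * (Real.sqrt P.d / (ℓ₀ - 2)) := mul_le_mul_of_nonneg_left h2 hD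
      _ = D * Real.sqrt P.d / (ℓ₀ - 2) := by ring
  have h1 := hstep z μ (by linarith)
  have h2 : ℓ₀ - 2 < (Site.tdist (z.unshift μ) b.src : ℝ) := by
    have h3 : (Site.tdist z b.src : ℝ) ≤ Site.tdist (z.unshift μ) b.src + 1 := by exact_mod_cast tdist_le_tdist_unshift_add_one z b.src μ
    linarith
  have h3 := hstep (z.unshift μ) μ h2
  rw [B10StarCount.shift_unshift] at h3
  calc |V (z.shift μ) - V (z.unshift μ)| = |(V (z.shift μ) - V z) + (V z - V (z.unshift μ))| := by ring_nf
    _ ≤ |V (z.shift μ) - V z| + |V z - V (z.unshift μ)| := abs_add_le _ _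
    _ ≤ D * Real.sqrt P.d / (ℓ₀ - 2) + D * Real.sqrt P.d / (ℓ₀ - 2) := add_le_add h1 h3
    _ = 2 * (D * Real.sqrt P.d) / (ℓ₀ - 2) := by ring

/-- **THE `Dg`-ROW ON THE ANNULUS**: if `|g z|·tdist(z,b₊)² ≤ D` for `z ≠ b₊` then `|g z| ≤ D∕(ℓ₀−2)²` whenever `tdist(z,b₋) > ℓ₀ − 1` (`ℓ₀ ≥ 3`).
[cite: Balaban1985RegularSpaces, (1.36) p.82] -/
theorem abs_g_le_of_row (b : PBond P 0) (g : SiteField P 0 ℝ) {D ℓ₀ : ℝ} (hℓ₀ : 3 ≤ ℓ₀)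
    (hrow : ∀ z, z ≠ b.tgt → |g z| * (Site.tdist z b.tgt : ℝ) ^ 2 ≤ D)
    (z : Site P 0) (hz : ℓ₀ - 1 < (Site.tdist z b.src : ℝ)) : |g z| ≤ D / (ℓ₀ - 2) ^ 2 := by
  have htgt : ℓ₀ - 2 < (Site.tdist z b.tgt : ℝ) := by
    have h2 : (Site.tdist z b.src : ℝ) ≤ Site.tdist z b.tgt + 1 := by
      have := B3Taylor310LocalRemainder.tdist_triangle z b.tgt b.src
      have h3 : Site.tdist b.tgt b.src ≤ 1 := by
        rw [B3Taylor310LocalRemainder.tdist_comm]; exact Summit.QuantumFields.Balaban3D.Proofs.Run3Collar.tdist_shift_le b.src b.dir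
      exact_mod_cast (this.trans (Nat.add_le_add_left h3 _))
    linarith
  have hℓ2 : 0 < ℓ₀ - 2 := by linarith
  have hzne : z ≠ b.tgt := by
    intro h; rw [h, B3Taylor310LocalRemainder.tdist_self] at htgt; push_cast at htgt; linarith
  have h := hrow z hzne
  have hsq : (ℓ₀ - 2) ^ 2 ≤ (Site.tdist z b.tgt : ℝ) ^ 2 := pow_le_pow_left₀ hℓ2.le htgt.le 2
  rw [le_div_iff₀ (pow_pos hℓ2 2)]
  exact (mul_le_mul_of_nonneg_left hsq (abs_nonneg _)).trans h

/-- **THE `Dg′`-ROW ON THE ANNULUS**: if `|g(z+e_ν) − g z|·tdist(z+e_ν,b₊)³ ≤ D` for `z+e_ν ≠ b₊` then `|g(z+e_μ) − g z| ≤ D∕(ℓ₀−3)³` whenever `tdist(z,b₋) > ℓ₀ − 1` (`ℓ₀ ≥ 4`).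
[cite: Balaban1985RegularSpaces, (1.36) p.82] -/
theorem abs_g_diff_le_of_row (b : PBond P 0) (g : SiteField P 0 ℝ) {D ℓ₀ : ℝ} (hℓ₀ : 4 ≤ ℓ₀)
    (hrow : ∀ z (ν : Fin P.d), z.shift ν ≠ b.tgt → |g (z.shift ν) - g z| * (Site.tdist (z.shift ν) b.tgt : ℝ) ^ 3 ≤ D)
    (z : Site P 0) (hz : ℓ₀ - 1 < (Site.tdist z b.src : ℝ)) (μ : Fin P.d) : |g (z.shift μ) - g z| ≤ D / (ℓ₀ - 3) ^ 3 := by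
  have htgt : ℓ₀ - 3 < (Site.tdist (z.shift μ) b.tgt : ℝ) := by
    have h2 : (Site.tdist z b.src : ℝ) ≤ Site.tdist (z.shift μ) b.tgt + 2 := by
      have e1 := tdist_le_tdist_shift_add_one z b.src μ
      have e2 := B3Taylor310LocalRemainder.tdist_triangle (z.shift μ) b.tgt b.src
      have e3 : Site.tdist b.tgt b.src ≤ 1 := by
        rw [B3Taylor310LocalRemainder.tdist_comm]; exact Summit.QuantumFields.Balaban3D.Proofs.Run3Collar.tdist_shift_le b.src b.dir
      have : Site.tdist z b.src ≤ Site.tdist (z.shift μ) b.tgt + 2 := by omega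
      exact_mod_cast this
    linarith
  have hℓ3 : 0 < ℓ₀ - 3 := by linarith
  have hzne : z.shift μ ≠ b.tgt := by
    intro h; rw [h, B3Taylor310LocalRemainder.tdist_self] at htgt; push_cast at htgt; linarith
  have h := hrow z μ hzne
  have hcube : (ℓ₀ - 3) ^ 3 ≤ (Site.tdist (z.shift μ) b.tgt : ℝ) ^ 3 := pow_le_pow_left₀ hℓ3.le htgt.le 3
  rw [le_div_iff₀ (pow_pos hℓ3 3)]
  exact (mul_le_mul_of_nonneg_left hcube (abs_nonneg _)).trans h

/-- the near-field radius does not wrap: `2⌈5√d·2ℓ⌉₊ < L^k·sitesPerDir k` when `d = 3` and `40 ≤ sitesPerDir k`. [folklore] -/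
theorem near_radius_lt (hd : P.d = 3) (k : ℕ) (hM : 40 ≤ P.sitesPerDir k) :
    2 * (⌈5 * Real.sqrt P.d * (2 * (P.L : ℝ) ^ k)⌉₊ : ℤ) < P.L ^ k * P.sitesPerDir k := by
  have hd3 : (P.d : ℝ) = 3 := by rw [hd]; norm_num
  have hℓ0 : (0 : ℝ) < (P.L : ℝ) ^ k := pow_pos (by exact_mod_cast P.L_pos) k
  have hs3 : Real.sqrt P.d ≤ 9 / 5 := by
    rw [hd3, show (9 / 5 : ℝ) = Real.sqrt ((9/5) ^ 2) by rw [Real.sqrt_sq (by norm_num)]]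
    exact Real.sqrt_le_sqrt (by norm_num)
  have hsd : 0 ≤ Real.sqrt P.d := Real.sqrt_nonneg _
  have h1 : 5 * Real.sqrt P.d * (2 * (P.L : ℝ) ^ k) ≤ 18 * (P.L : ℝ) ^ k := by
    calc 5 * Real.sqrt P.d * (2 * (P.L : ℝ) ^ k) = (10 * Real.sqrt P.d) * (P.L : ℝ) ^ k := by ring
      _ ≤ (10 * (9 / 5)) * (P.L : ℝ) ^ k := mul_le_mul_of_nonneg_right (by linarith) hℓ0.le
      _ = 18 * (P.L : ℝ) ^ k := by ring
  have h0 : 0 ≤ 5 * Real.sqrt P.d * (2 * (P.L : ℝ) ^ k) := by positivity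
  have h2 : (⌈5 * Real.sqrt P.d * (2 * (P.L : ℝ) ^ k)⌉₊ : ℝ) < 18 * (P.L : ℝ) ^ k + 1 := lt_of_lt_of_le (Nat.ceil_lt_add_one h0) (by linarith)
  have h3 : (⌈5 * Real.sqrt P.d * (2 * (P.L : ℝ) ^ k)⌉₊ : ℝ) < 19 * ((P.L ^ k : ℕ) : ℝ) := by
    have hℓ1 : (1 : ℝ) ≤ (P.L : ℝ) ^ k := one_le_pow₀ (by exact_mod_cast P.L_pos)
    push_cast; linarith
  have h4 : (⌈5 * Real.sqrt P.d * (2 * (P.L : ℝ) ^ k)⌉₊ : ℤ) < 19 * ((P.L ^ k : ℕ) : ℤ) := by exact_mod_cast h3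
  have h5 : (40 : ℤ) * ((P.L ^ k : ℕ) : ℤ) ≤ ((P.L ^ k : ℕ) : ℤ) * (P.sitesPerDir k : ℤ) := by
    have : (40 : ℤ) ≤ (P.sitesPerDir k : ℤ) := by exact_mod_cast hM
    have h0' : (0 : ℤ) ≤ ((P.L ^ k : ℕ) : ℤ) := by positivity
    nlinarith
  push_cast at h4 h5 ⊢
  linarith

end Summit.QuantumFields.YangMills.Theorems.Prop7PinnedKernelL1Rows

end
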